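import Mathlib
import HarnessLib
import Summits.ValiantsHypothesis.ValiantsHypothesis.Theses.MonotoneRestoration
import Literature.ModelTheory.FiniteModelTheory.CkEquiv

/-!
# ValiantsHypothesis / MonotoneRestoration — `MonotoneRestorationQP`, line `Sketch`, stub S4

Support file for crux item `stmt-ValiantsHypothesis-15886`
(`Summit.ValiantsHypothesis.ValiantsHypothesis.Theses.MonotoneRestoration.MonotoneRestorationQP`),
line `Sketch`, stub `stub_symmetricLB_of_linearCountingWidth` (the symmetric lower-bound pipeline
for an ARBITRARY family of polynomials on the `n × n` variable matrix).

The statement is the printed deduction of Dawar–Wilsenach 2025, Theorem 7.1 (p. 19) with the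
permanent replaced by an arbitrary family `p = (p_n)`: if for some `c` and every `k` the family
separates two `C^k`-equivalent graphs `X_k ≡^{C^k} Y_k` on `m_k ≤ c·k + c` common vertices (its
values at the two `0/1` adjacency matrices differ), then `p` has no square-symmetric circuits of
quasi-polynomial size `2^{(log₂ n + c')^{c'}}`.

Proof (the template is `Literature.Computability.AlgebraicComplexity.DawarWilsenach2025_thm71_of_thm51_thm64_thm72`):
* size `2^{(log₂ n + c')^{c'}}` is orbit size `2^{o(n)}` (`LabelledArithCircuit.orbitSize_le_size`
  and `(log₂ n + c')^{c'} < δ n` for `n ≥ 2^{k₀}`, `symmetricLB_logPow_lt`, adapted from the route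
  file's deciding theorem);
* a square-symmetric single-output circuit computes a `Sym_n`-invariant polynomial
  (`IsSymmetric.rename_eval_output_unit`), so its value at an adjacency matrix is an isomorphism
  invariant (`symmetricLB_eval_perm_eq`); hence the separated graphs are not isomorphic and
  `k < m_k` (`CkEquiv.nonempty_iso`);
* Theorem 5.1 (`DawarWilsenach2025_thm51_family`, PROVED) translates the family into symmetric
  threshold circuits of orbit size `2^{o(n)}` deciding the class
  `𝒞 = {Γ : p(Γ) = p(X_{k(n)})}` (one selected index `k(n)` with `m_{k(n)} = n`), and Theorem 6.4
  (`DawarWilsenach2025_orbitSize_countingWidth_holds`, PROVED) with `ε = 1/(2c+2)` makes `𝒞`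
  `≡^{C^k}`-invariant at a large order `m_{k'}`, `k' ≥ ε m_{k'}` — contradicting the separation.

No new definitions.
-/

-- `Summit.ValiantsHypothesis.ValiantsHypothesis.…` is the tree's mandated single-conjunct layout
-- (Sub = Summit), so the duplicated namespace component is intended.
set_option linter.dupNamespace false

namespace Summit.ValiantsHypothesis.ValiantsHypothesis.Theorems

open Literature.Computability.AlgebraicComplexity
open Literature.ModelTheory.FiniteModelTheory
open Filter

/-- **Quasi-polynomial against exponential.** For every `δ > 0` there is `k₀` with
`(log₂ n + c)^c < δ·n` for all `n ≥ 2^{k₀}` (`k^c / 2^k → 0`). [folklore] -/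
theorem symmetricLB_logPow_lt (c : ℕ) {δ : ℝ} (hδ : 0 < δ) :
    ∃ k₀ : ℕ, ∀ n : ℕ, 2 ^ k₀ ≤ n → ((Nat.log 2 n + c) ^ c : ℝ) < δ * n := by
  -- adapted from the deciding theorem `closes` of Theses/MonotoneRestoration.lean
  -- (i) polynomial versus exponential in `k = log₂ n`
  have hlim : Filter.Tendsto (fun k : ℕ => (k : ℝ) ^ c / (2 : ℝ) ^ k) Filter.atTop (nhds 0) :=
    tendsto_pow_const_div_const_pow_of_one_lt c one_lt_two
  have hδ' : 0 < δ / 2 ^ c := by positivity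
  obtain ⟨k₁, hk₁⟩ := Filter.eventually_atTop.1 (hlim.eventually (gt_mem_nhds hδ'))
  -- (ii) the threshold
  refine ⟨max k₁ c, fun n hn => ?_⟩
  have hn0 : n ≠ 0 := by
    have : 0 < 2 ^ max k₁ c := Nat.two_pow_pos _
    omega
  set k := Nat.log 2 n with hkdef
  have hk : max k₁ c ≤ k := by
    rw [hkdef]
    calc max k₁ c = Nat.log 2 (2 ^ max k₁ c) := (Nat.log_pow Nat.one_lt_two _).symm
      _ ≤ Nat.log 2 n := Nat.log_mono_right hn
  have hkc : c ≤ k := le_trans (le_max_right _ _) hk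
  have hk1 : k₁ ≤ k := le_trans (le_max_left _ _) hk
  -- `(k + c)^c ≤ (2k)^c = 2^c k^c`
  have hA : ((k + c) ^ c : ℝ) ≤ (2 : ℝ) ^ c * (k : ℝ) ^ c := by
    have : (k + c : ℝ) ≤ 2 * k := by
      have : (c : ℝ) ≤ k := by exact_mod_cast hkc
      linarith
    calc ((k + c) ^ c : ℝ) ≤ (2 * (k : ℝ)) ^ c := by
          exact pow_le_pow_left₀ (by positivity) this c
      _ = (2 : ℝ) ^ c * (k : ℝ) ^ c := by rw [mul_pow]
  -- `k^c < (δ / 2^c) 2^k`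
  have hB : (k : ℝ) ^ c < δ / 2 ^ c * (2 : ℝ) ^ k := by
    have h := hk₁ k hk1
    have h2k : (0 : ℝ) < (2 : ℝ) ^ k := by positivity
    rwa [div_lt_iff₀ h2k] at h
  -- `2^k ≤ n`
  have hC : ((2 : ℝ) ^ k : ℝ) ≤ n := by
    have := Nat.pow_log_le_self 2 hn0
    rw [← hkdef] at this
    exact_mod_cast this
  have h2c : (0 : ℝ) < (2 : ℝ) ^ c := by positivity
  calc ((Nat.log 2 n + c) ^ c : ℝ) = ((k + c) ^ c : ℝ) := by rw [hkdef]
    _ ≤ (2 : ℝ) ^ c * (k : ℝ) ^ c := hA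
    _ < (2 : ℝ) ^ c * (δ / 2 ^ c * (2 : ℝ) ^ k) := by
        exact mul_lt_mul_of_pos_left hB h2c
    _ = δ * (2 : ℝ) ^ k := by field_simp
    _ ≤ δ * n := by exact mul_le_mul_of_nonneg_left hC hδ.le

/-- **Quasi-polynomial size is orbit size `2^{o(n)}`.** A family of labelled circuits with at most
`2^{(log₂ n + c)^c}` gates has, for every `ε > 0`, orbit size at most `2^{ε n}` for all large `n`
(an orbit is a set of gates, `LabelledArithCircuit.orbitSize_le_size`). [folklore] -/
theorem symmetricLB_orbitSize_small {G : ℕ → Type} [∀ n, Fintype (G n)]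
    (C : ∀ n, LabelledArithCircuit ℂ (Fin n × Fin n) Unit (G n)) {c : ℕ}
    (hcard : ∀ n, Fintype.card (G n) ≤ 2 ^ ((Nat.log 2 n + c) ^ c)) :
    ∀ ε : ℝ, 0 < ε → ∀ᶠ n : ℕ in Filter.atTop,
      ((C n).orbitSize (Equiv.Perm (Fin n)) : ℝ) ≤ (2 : ℝ) ^ (ε * (n : ℝ)) := by
  intro ε hε
  obtain ⟨k₀, hk₀⟩ := symmetricLB_logPow_lt c hε
  refine Filter.eventually_atTop.2 ⟨2 ^ k₀, fun n hn => ?_⟩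
  have h1 : ((C n).orbitSize (Equiv.Perm (Fin n)) : ℝ) ≤
      (2 : ℝ) ^ (((Nat.log 2 n + c) ^ c : ℕ) : ℝ) := by
    rw [Real.rpow_natCast]
    have h := ((C n).orbitSize_le_size (Equiv.Perm (Fin n))).trans (hcard n)
    exact_mod_cast h
  refine h1.trans ?_
  apply (Real.rpow_le_rpow_left_iff one_lt_two).2
  have h2 := hk₀ n hn
  push_cast at h2 ⊢
  exact h2.le

/-- **A square-symmetric single-output circuit computes a `Sym_n`-invariant polynomial**, so its
value does not change when the rows and columns of the input are permuted simultaneously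
(`IsSymmetric.rename_eval_output_unit` and `MvPolynomial.eval_rename`). [folklore] -/
theorem symmetricLB_eval_perm_eq {n : ℕ} {G : Type}
    (C : LabelledArithCircuit ℂ (Fin n × Fin n) Unit G) (hC : C.IsSymmetric (Equiv.Perm (Fin n)))
    (γ : Equiv.Perm (Fin n)) (A B : Fin n × Fin n → ℂ) (hAB : ∀ ij, B ij = A (γ ij.1, γ ij.2)) :
    MvPolynomial.eval B (C.eval (C.output ())) = MvPolynomial.eval A (C.eval (C.output ())) := by
  have hBA : B = A ∘ fun x => γ • x := by
    funext ij
    rw [hAB ij]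
    rfl
  conv_rhs => rw [← hC.rename_eval_output_unit γ]
  rw [MvPolynomial.eval_rename, hBA]

/-- **S4 — the symmetric lower-bound pipeline for an arbitrary family** (Dawar–Wilsenach 2025,
proof of Thm 7.1 with `per` replaced by any family; Thm 5.1 = `DawarWilsenach2025_thm51_family` and
Thm 6.4 = `DawarWilsenach2025_orbitSize_countingWidth_holds` are PROVED in the tree): if for some
`c` and every `k` the family `p` takes different values at the adjacency matrices of two
`C^k`-equivalent graphs on `m ≤ c·k + c` vertices, then `p` has no quasi-polynomial-size
square-symmetric circuits. [cite: DawarWilsenach2025, §7.1 (proof of Thm 7.1, p. 19)] -/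
theorem stub_symmetricLB_of_linearCountingWidth : ∀ (p : (n : ℕ) → MvPolynomial (Fin n × Fin n) ℂ),
    (∃ c : ℕ, ∀ k : ℕ, ∃ m : ℕ, m ≤ c * k + c ∧ ∃ X Y : SimpleGraph (Fin m),
      Literature.ModelTheory.FiniteModelTheory.CkEquiv k X Y ∧
      MvPolynomial.eval (Set.indicator {ij : Fin m × Fin m | X.Adj ij.1 ij.2} 1) (p m) ≠
        MvPolynomial.eval (Set.indicator {ij : Fin m × Fin m | Y.Adj ij.1 ij.2} 1) (p m)) →
    ¬ ∃ c : ℕ, ∀ n : ℕ, ∃ (G : Type) (_ : Fintype G)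
        (C : LabelledArithCircuit ℂ (Fin n × Fin n) Unit G),
      C.IsSymmetric (Equiv.Perm (Fin n)) ∧ C.eval (C.output ()) = p n ∧
      Fintype.card G ≤ 2 ^ ((Nat.log 2 n + c) ^ c) := by
  intro p hsep hqp
  classical
  -- (i) the quasi-polynomial square-symmetric circuits, of orbit size `2^{o(n)}`
  obtain ⟨c₁, hc₁⟩ := hqp
  choose G inst C hsym heval hcard using hc₁
  have hsmall : ∀ ε : ℝ, 0 < ε → ∀ᶠ n : ℕ in atTop,
      ((C n).orbitSize (Equiv.Perm (Fin n)) : ℝ) ≤ (2 : ℝ) ^ (ε * (n : ℝ)) :=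
    symmetricLB_orbitSize_small C hcard
  -- the separated `C^k`-equivalent graphs
  obtain ⟨c, hc⟩ := hsep
  choose m hm X Y hXY hne' using hc
  -- Boolean adjacency matrices and the value of `p` at them
  let adjB : ∀ n, SimpleGraph (Fin n) → Fin n × Fin n → Bool := fun n Γ ij =>
    decide (Γ.Adj ij.1 ij.2)
  let val : ∀ n, (Fin n × Fin n → Bool) → ℂ := fun n A =>
    MvPolynomial.eval (fun ij => if A ij = true then (1 : ℂ) else 0) (p n)
  have hval : ∀ (n : ℕ) (Γ : SimpleGraph (Fin n)), val n (adjB n Γ) =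
      MvPolynomial.eval (fun ij : Fin n × Fin n => if Γ.Adj ij.1 ij.2 then (1 : ℂ) else 0)
        (p n) := by
    intro n Γ
    have hfun : (fun ij : Fin n × Fin n => if decide (Γ.Adj ij.1 ij.2) = true then (1 : ℂ) else 0) =
        fun ij => if Γ.Adj ij.1 ij.2 then (1 : ℂ) else 0 := by
      funext ij
      by_cases h : Γ.Adj ij.1 ij.2 <;> simp [h]
    simp only [val, adjB]
    rw [hfun]
  have hind : ∀ (n : ℕ) (Γ : SimpleGraph (Fin n)),
      Set.indicator {ij : Fin n × Fin n | Γ.Adj ij.1 ij.2} (1 : Fin n × Fin n → ℂ) =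
        fun ij : Fin n × Fin n => if Γ.Adj ij.1 ij.2 then (1 : ℂ) else 0 := by
    intro n Γ
    funext ij
    by_cases h : Γ.Adj ij.1 ij.2 <;> simp [h]
  -- the two graphs have different values ...
  have hne : ∀ k, val (m k) (adjB (m k) (X k)) ≠ val (m k) (adjB (m k) (Y k)) := by
    intro k h
    apply hne' k
    rw [hind, hind, ← hval, ← hval]
    exact h
  -- ... hence (the value being an isomorphism invariant, by symmetry) are not isomorphic: `k < m k`
  have hkm : ∀ k, k < m k := by
    intro k
    by_contra hk
    have hk' : m k ≤ k := not_lt.mp hk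
    apply hne k
    rcases Nat.eq_zero_or_pos (m k) with h0 | hpos
    · have hXYeq : X k = Y k := by
        ext a b
        exact absurd a.isLt (by omega)
      rw [hXYeq]
    · obtain ⟨e⟩ := (hXY k).nonempty_iso (by omega) (by simpa using hk')
      rw [hval, hval, ← heval (m k)]
      refine symmetricLB_eval_perm_eq (C (m k)) (hsym (m k)) e.toEquiv _ _ fun ij => ?_
      by_cases h : (X k).Adj ij.1 ij.2
      · have h' : (Y k).Adj (e ij.1) (e ij.2) := e.map_adj_iff.2 h
        simp [h, h']
      · have h' : ¬ (Y k).Adj (e ij.1) (e ij.2) := fun h'' => h (e.map_adj_iff.1 h'')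
        simp [h, h']
  -- one index `k(n)` with `m (k(n)) = n` whenever there is one; the sets `S_n`; the class `𝒞`
  let ksel : ℕ → ℕ := fun n => if h : ∃ k, m k = n then h.choose else 0
  have hksel : ∀ k, m (ksel (m k)) = m k := by
    intro k
    have h : ∃ k', m k' = m k := ⟨k, rfl⟩
    simp only [ksel, dif_pos h]
    exact h.choose_spec
  let S : ℕ → Set ℂ := fun n => {val (m (ksel n)) (adjB (m (ksel n)) (X (ksel n)))}
  have hSfin : ∀ n, (S n).Finite := fun n => Set.finite_singleton _
  let 𝒞 : Set FinGraph := {Γ | val Γ.1 (adjB Γ.1 Γ.2) ∈ S Γ.1}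
  -- (ii) Theorem 5.1: symmetric threshold circuits of orbit size `2^{o(n)}` deciding `𝒞`
  obtain ⟨Ψ, hΨ, hΨorb, hΨeval⟩ := DawarWilsenach2025_thm51_family ℂ G C S hsym hSfin hsmall
  have hdec : DecidesGraphClass 𝒞 Ψ := by
    intro n Γ _
    rw [hΨeval n (adjInput Γ), heval n]
    have hA : adjInput Γ = adjB n Γ := by
      funext ij
      simp [adjInput_apply, adjB]
    rw [hA]
    exact Iff.rfl
  -- (iii) Theorem 6.4 with `ε = 1 / (2c + 2)`
  set ε : ℝ := 1 / (2 * (c : ℝ) + 2) with hε_def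
  have hε : 0 < ε := by positivity
  have hinv := DawarWilsenach2025_orbitSize_countingWidth_holds 𝒞 Ψ hΨ hdec hΨorb ε hε
  rw [Filter.eventually_atTop] at hinv
  obtain ⟨N, hN⟩ := hinv
  -- a large order of the form `m k'` with `k'` the selected index
  set k₀ : ℕ := N + c + 1 with hk₀_def
  set k' : ℕ := ksel (m k₀) with hk'_def
  have hmk' : m k' = m k₀ := hksel k₀
  have hk₀m : k₀ < m k₀ := hkm k₀
  have hn_ge : N ≤ m k' := by
    rw [hmk']
    omega
  have hεk : ε * ((m k' : ℕ) : ℝ) ≤ (k' : ℝ) := by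
    have h1 : m k' ≤ c * k' + c := hm k'
    have hk'1 : 1 ≤ k' := by
      by_contra h0
      have hz : k' = 0 := by omega
      have h1' : m k' ≤ c := by
        calc m k' ≤ c * k' + c := h1
          _ = c := by rw [hz, mul_zero, zero_add]
      omega
    have h1' : ((m k' : ℕ) : ℝ) ≤ (c : ℝ) * (k' : ℝ) + (c : ℝ) := by exact_mod_cast h1
    have hk1' : (1 : ℝ) ≤ (k' : ℝ) := by exact_mod_cast hk'1
    have hc0 : (0 : ℝ) ≤ (c : ℝ) := Nat.cast_nonneg c
    have h2 : ((m k' : ℕ) : ℝ) ≤ (2 * (c : ℝ) + 2) * (k' : ℝ) := by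
      nlinarith [mul_nonneg hc0 (sub_nonneg.mpr hk1')]
    rw [hε_def, one_div, inv_mul_le_iff₀ (by positivity)]
    exact h2
  have hI : IsCkInvariantAt 𝒞 (m k') k' := hN (m k') hn_ge k' hεk
  have hsel : ksel (m k') = k' := by
    rw [hmk']
  have hX : (⟨m k', X k'⟩ : FinGraph) ∈ 𝒞 := by
    show val (m k') (adjB (m k') (X k')) ∈ S (m k')
    simp only [S, Set.mem_singleton_iff]
    rw [hsel]
  have hY : (⟨m k', Y k'⟩ : FinGraph) ∉ 𝒞 := by
    show val (m k') (adjB (m k') (Y k')) ∉ S (m k')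
    simp only [S, Set.mem_singleton_iff]
    rw [hsel]
    exact (hne k').symm
  exact hY ((hI (X k') (Y k') (hXY k')).mp hX)

end Summit.ValiantsHypothesis.ValiantsHypothesis.Theorems
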